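import Summits.QuantumFields.YangMills.Theorems.FluctuationComparisonRegPrIntLS1aInvariantVersion
import Literature.MathematicalPhysics.QuantumFieldTheory.Balaban1983to89.T3RestrictedUnitDensity
import Literature.MathematicalPhysics.QuantumFieldTheory.Balaban1983to89.T3UnitLawGaugeInvariance
import HarnessLib

/-!
# `FluctuationComparisonRegPrIntLS1aLevelLawInvariance` — THE RUN-`K` LEVEL-`k` LAW `(Averaging.iter blockAvg k)_* (e^{−β_K A}·dU₀)` HAS DENSITY `resDensity F γ K univ k`, IS GAUGE
# INVARIANT, its density is a.e. gauge invariant, and the Γ-averaged canonical version `canonVersion dU_k (orbAvg ρ_k)` carries the (m2) door's version fields (annex «WANTED» by px8 g23)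

Cell `ym3-torus` (HUMAN RULING D-0037: rung R3 = continuum SU(2) Yang–Mills on T³ — NOT d = 4, NOT infinite volume, NOT a mass gap, NOT Clay), WIDTH COPY «width 17»
of ym3-torus-p1, seat `ym3-torus-px17` gen 20; `--kind proof --supports stmt-QuantumFields-20520 --as helper` (count-neutral).  THEOREMS ONLY (no `def`, no `sorry`,
no `instance`, no `notation`, default heartbeats).  The run-`K`-LEVEL sibling of ✓p821154 `…S1aTowerLawInvariance` (which lives at the HEIGHT lattices `(F.P j, 0)`), asked
for by px8 g23 11:52:06Z «WANTED» to dock ✓p822164 `…S1aAlphaMemVersionOfRows` (`mem_version_of_alphaRows`: `ρ ≥ 0` measurable GAUGE INVARIANT with (47′)∕(41′) POINTWISE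
on the window) on ONE named version of `resDensity F γ K univ k`.

CONTENT (`k ≤ m + K`, `γ ≥ 0`, `SU(2)`, the printed smearing `ℰp`).
* `measure_eq_of_integral_eq` (finite measures agree when bounded measurable integrals do; indicators).
* ★`map_iter_withDensity_boltzmann_eq`: `(dU₀.withDensity (ofReal ∘ e^{−β_K A})).map (iter blockAvg k) = dU_k.withDensity (ofReal ∘ resDensity F γ K univ k)` — the
  tree's RT identity lit ✓`T3RestrictedUnitDensity.integral_resDensity_mul` ([Balaban1985Averaging] (10), [Balaban1985UV3] (2)∕(6)) read as an equality of measures.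
* ★`map_gaugeAct_levelLaw`: that law is invariant under every gauge transformation `w` of `T^{(k)}` (`w = (u ↦ u^{(k)})` of the block-constant lift, lit
  ✓`T3UnitLawGaugeInvariance.transfUp_blockUp`; covariance lit ✓`T4Continuum.iter_gaugeAct`; invariance of the Boltzmann measure lit ✓`boltzmann_gaugeAct` +
  ✓`B12RTGaugeInvariance254.measurePreserving_gaugeAct`) — [Balaban1985Averaging] (11)–(13).
* ★★`resDensity_comp_gaugeAct_ae_eq`: `ρ_k(W^w) = ρ_k(W)` for `dU_k`-a.e. `W` (✓p820698 `comp_gaugeAct_ae_eq_of_map_withDensity_eq`).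
* ★★★`levelVersion_spec`: for `ρ♮ := canonVersion dU_k (orbAvg (resDensity F γ K univ k))` — `GaugeInvariant ρ♮` POINTWISE, `Measurable ρ♮`, `0 ≤ ρ♮`, `ρ♮ = ρ_k` a.e., `ContinuousOn ρ♮
  (regSet dU_k ρ_k)`, and on every open `U ⊆ regSet dU_k ρ_k` every a.e. bound `f ≤ ρ_k` ∕ `ρ_k ≤ g` with `f`, `g` continuous on `U` holds for `ρ♮` at EVERY point of `U` (the
  (m2) door's `hρ0`∕`hρm`∕`hρGI` free; its `h47ρ`∕`h41ρ` from `Ineq47AE`∕`Ineq41AE` given window continuity of `low`∕`up` and `window ⊆ regSet` — UV3-NODE §69.2 δ7∕δ11, §77).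

HONEST FRAMING.  Measure-theoretic bookkeeping over landed tree facts; nothing of Bałaban's analysis is asserted or proved; the residuals «window ⊆ regSet dU_k ρ_k» (§67.3 (c)
for the full level-`k` marginal) and «`low`∕`up` continuous on the window» (δ7's own) stay DISPLAYED at the consumer; S1a(ᴴ) (m) AS TYPED misstated by currency (RULING №80) ∕
AS PRINTED OPEN; the five registered stubs of `Lines/semiclassical_s2beta.lean`, crux 20520 ∕ 19936 ∕ 19200 and `YM3TorusSU2` are NOT proved; no registered stub is closed;
registry untouched; rung R3 = SU(2) YM₃ on T³ at fixed lattice data — NOT d = 4, NOT infinite volume, NOT a mass gap, NOT Clay; the Yang–Mills mass gap is NOT proved.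
References: [Balaban1985Averaging] CMP 98 (1985) (10)–(13) p. 19; [Balaban1985UV3] CMP 102 (1985) (2) p. 256, (6) p. 257, (41) p. 266, (47) p. 267.
-/

set_option autoImplicit false

noncomputable section

namespace Summit.QuantumFields.YangMills.Theorems.FluctuationComparisonRegPrIntLS1aLevelLawInvariance

open MeasureTheory Filter Topology Set Function
open scoped ENNReal NNReal
open Literature.MathematicalPhysics.QuantumFieldTheory.Balaban1983to89
open T3ContinuumYM3Torus T3UnitLawDensityEML T3UnitScaleTilt T3RestrictedUnitDensity T4Continuum Missing
open Literature.MathematicalPhysics.QuantumFieldTheory.Balaban1983to89.Node00 (canonVersion regSet)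
open Literature.MathematicalPhysics.QuantumFieldTheory.Balaban1983to89.T3OrbitAverage (orbAvg)
open Literature.MathematicalPhysics.QuantumFieldTheory.Balaban1983to89.B12RTGaugeInvariance254 (measurable_gaugeAct measurePreserving_gaugeAct)
open Literature.MathematicalPhysics.QuantumFieldTheory.Balaban1983to89.T3UnitLawGaugeInvariance (boltzmann_gaugeAct transfUp_blockUp blockUp)
open Summit.QuantumFields.YangMills.Theorems.FluctuationComparisonRegPrIntLS1aInvariantVersion

variable (F : T3Family) {γ : ℝ}

/-- A finite measure is determined by the integrals of bounded measurable real functions (indicators suffice). [folklore] -/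
theorem measure_eq_of_integral_eq {X : Type*} [MeasurableSpace X] {μ ν : Measure X} [IsFiniteMeasure μ] [IsFiniteMeasure ν]
    (h : ∀ f : X → ℝ, Measurable f → (∀ x, |f x| ≤ 1) → ∫ x, f x ∂μ = ∫ x, f x ∂ν) : μ = ν := by
  refine Measure.ext fun s hs => ?_
  have hi : Measurable (s.indicator (1 : X → ℝ)) := measurable_one.indicator hs
  have hb : ∀ x, |s.indicator (1 : X → ℝ) x| ≤ 1 := fun x => by
    by_cases hx : x ∈ s
    · simp [Set.indicator_of_mem hx]
    · simp [Set.indicator_of_notMem hx]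
  have h1 := h _ hi hb
  rw [integral_indicator_one hs, integral_indicator_one hs] at h1
  exact (ENNReal.toReal_eq_toReal_iff' (measure_ne_top μ s) (measure_ne_top ν s)).1 (by exact_mod_cast h1)

/-- ★ **THE LEVEL-`k` LAW OF RUN `K` HAS DENSITY `resDensity F γ K univ k`**: the push-forward of the Boltzmann measure `e^{−β_K A}·dU₀` of run `K` under `k` block
averagings is `dU_k.withDensity (ofReal ∘ resDensity F γ K univ k)` (`k ≤ m + K`, `γ ≥ 0`; lit ✓`integral_resDensity_mul` tested on indicators).
[cite: Balaban1985UV3, (2) p.256 and (6) p.257] -/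
theorem map_iter_withDensity_boltzmann_eq (hγ : 0 ≤ γ) (K : ℕ) {k : ℕ} (hk : k ≤ F.m + K) :
    ((fieldMeasure (F.P K) 0 ↥(Matrix.specialUnitaryGroup (Fin 2) ℂ)).withDensity
        (fun U => ENNReal.ofReal (boltzmann (F.P K) ((F.scheme ℰp γ).β K) U))).map
        (Averaging.iter (fun j => BlockAveraging.blockAvg (P := F.P K) (j := j) ℰp) k) =
      (fieldMeasure (F.P K) k ↥(Matrix.specialUnitaryGroup (Fin 2) ℂ)).withDensity
        (fun W => ENNReal.ofReal (resDensity F γ K Set.univ k W)) := by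
  have hbm : Measurable (boltzmann (G := ↥(Matrix.specialUnitaryGroup (Fin 2) ℂ)) (F.P K) ((F.scheme ℰp γ).β K)) :=
    measurable_boltzmann RegularGaugeGroup.measurable_reTr _ _
  have hbi : Integrable (boltzmann (G := ↥(Matrix.specialUnitaryGroup (Fin 2) ℂ)) (F.P K) ((F.scheme ℰp γ).β K))
      (fieldMeasure (F.P K) 0 ↥(Matrix.specialUnitaryGroup (Fin 2) ℂ)) :=
    integrable_boltzmann RegularGaugeGroup.measurable_reTr _ (F.scheme_β_nonneg ℰp hγ K)
  have hri : Integrable (resDensity F γ K Set.univ k) (fieldMeasure (F.P K) k ↥(Matrix.specialUnitaryGroup (Fin 2) ℂ)) :=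
    integrable_resDensity F K MeasurableSet.univ hγ hk
  have hrm : Measurable (resDensity F γ K Set.univ k) := measurable_resDensity F γ K MeasurableSet.univ k
  have hI : Measurable (Averaging.iter (fun j => BlockAveraging.blockAvg (P := F.P K) (j := j) ℰp) k) :=
    measurable_iter _ (F.avgMeasurable_of_measurableE ℰp measurableE_ℰp K) k
  haveI : IsFiniteMeasure (((fieldMeasure (F.P K) 0 ↥(Matrix.specialUnitaryGroup (Fin 2) ℂ)).withDensity
      (fun U => ENNReal.ofReal (boltzmann (F.P K) ((F.scheme ℰp γ).β K) U))).map
      (Averaging.iter (fun j => BlockAveraging.blockAvg (P := F.P K) (j := j) ℰp) k)) := by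
    haveI : IsFiniteMeasure ((fieldMeasure (F.P K) 0 ↥(Matrix.specialUnitaryGroup (Fin 2) ℂ)).withDensity
        (fun U => ENNReal.ofReal (boltzmann (F.P K) ((F.scheme ℰp γ).β K) U))) := isFiniteMeasure_withDensity_ofReal hbi.2
    exact Measure.isFiniteMeasure_map _ _
  haveI : IsFiniteMeasure ((fieldMeasure (F.P K) k ↥(Matrix.specialUnitaryGroup (Fin 2) ℂ)).withDensity
      (fun W => ENNReal.ofReal (resDensity F γ K Set.univ k W))) := isFiniteMeasure_withDensity_ofReal hri.2
  refine measure_eq_of_integral_eq fun f hf hb => ?_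
  rw [integral_map hI.aemeasurable hf.aestronglyMeasurable,
    integral_withDensity_eq_integral_toReal_smul hbm.ennreal_ofReal (Filter.Eventually.of_forall fun _ => ENNReal.ofReal_lt_top),
    integral_withDensity_eq_integral_toReal_smul hrm.ennreal_ofReal (Filter.Eventually.of_forall fun _ => ENNReal.ofReal_lt_top)]
  simp only [ENNReal.toReal_ofReal (boltzmann_pos _ _ _).le, ENNReal.toReal_ofReal (resDensity_nonneg F γ K _ k _), smul_eq_mul]
  have h := integral_resDensity_mul F K (S := Set.univ) MeasurableSet.univ hγ hk f hf ⟨1, hb⟩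
  simp only [Set.indicator_univ] at h
  exact h.symm

/-- ★ **THE LEVEL-`k` LAW OF RUN `K` IS GAUGE INVARIANT**: every gauge transformation `w` of `T^{(k)}` is the block-centre restriction of a finest-lattice one
(lit ✓`transfUp_blockUp`), the iterated averaging is covariant (lit ✓`iter_gaugeAct`), and the Boltzmann measure is invariant (lit ✓`boltzmann_gaugeAct`,
✓`measurePreserving_gaugeAct`). [cite: Balaban1985Averaging, (11)-(13) p.19] -/
theorem map_gaugeAct_levelLaw (K : ℕ) {k : ℕ} (hk : k ≤ F.m + K) (w : GaugeTransf (F.P K) k ↥(Matrix.specialUnitaryGroup (Fin 2) ℂ)) :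
    (((fieldMeasure (F.P K) 0 ↥(Matrix.specialUnitaryGroup (Fin 2) ℂ)).withDensity
        (fun U => ENNReal.ofReal (boltzmann (F.P K) ((F.scheme ℰp γ).β K) U))).map
        (Averaging.iter (fun j => BlockAveraging.blockAvg (P := F.P K) (j := j) ℰp) k)).map (GaugeField.gaugeAct w) =
      ((fieldMeasure (F.P K) 0 ↥(Matrix.specialUnitaryGroup (Fin 2) ℂ)).withDensity
        (fun U => ENNReal.ofReal (boltzmann (F.P K) ((F.scheme ℰp γ).β K) U))).map
        (Averaging.iter (fun j => BlockAveraging.blockAvg (P := F.P K) (j := j) ℰp) k) := by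
  have hk' : k ≤ (F.P K).m + (F.P K).K := by show k ≤ F.m + K; exact hk
  have hI : Measurable (Averaging.iter (fun j => BlockAveraging.blockAvg (P := F.P K) (j := j) ℰp) k) :=
    measurable_iter _ (F.avgMeasurable_of_measurableE ℰp measurableE_ℰp K) k
  set u : GaugeTransf (F.P K) 0 ↥(Matrix.specialUnitaryGroup (Fin 2) ℂ) := fun z => w (blockUp k z) with hu
  have htu : transfUp u k = w := transfUp_blockUp k hk' w
  have hcomm : (GaugeField.gaugeAct w) ∘ (Averaging.iter (fun j => BlockAveraging.blockAvg (P := F.P K) (j := j) ℰp) k) =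
      (Averaging.iter (fun j => BlockAveraging.blockAvg (P := F.P K) (j := j) ℰp) k) ∘
        (GaugeField.gaugeAct u : GaugeField (F.P K) 0 ↥(Matrix.specialUnitaryGroup (Fin 2) ℂ) → _) := by
    funext U
    show GaugeField.gaugeAct w (Averaging.iter _ k U) = Averaging.iter _ k (GaugeField.gaugeAct u U)
    rw [iter_gaugeAct _ u k hk' U, htu]
  -- the Boltzmann measure is invariant under `u`
  have hbm : Measurable (boltzmann (G := ↥(Matrix.specialUnitaryGroup (Fin 2) ℂ)) (F.P K) ((F.scheme ℰp γ).β K)) :=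
    measurable_boltzmann RegularGaugeGroup.measurable_reTr _ _
  have hB : ((fieldMeasure (F.P K) 0 ↥(Matrix.specialUnitaryGroup (Fin 2) ℂ)).withDensity
        (fun U => ENNReal.ofReal (boltzmann (F.P K) ((F.scheme ℰp γ).β K) U))).map (GaugeField.gaugeAct u) =
      (fieldMeasure (F.P K) 0 ↥(Matrix.specialUnitaryGroup (Fin 2) ℂ)).withDensity
        (fun U => ENNReal.ofReal (boltzmann (F.P K) ((F.scheme ℰp γ).β K) U)) := by
    have e : (fun U : GaugeField (F.P K) 0 ↥(Matrix.specialUnitaryGroup (Fin 2) ℂ) => ENNReal.ofReal (boltzmann (F.P K) ((F.scheme ℰp γ).β K) U))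
        = fun U => ENNReal.ofReal (boltzmann (F.P K) ((F.scheme ℰp γ).β K) (GaugeField.gaugeAct u U)) :=
      funext fun U => by rw [boltzmann_gaugeAct]
    conv_lhs => rw [e]
    -- `(μ.withDensity (d ∘ T)).map T = (μ.map T).withDensity d` (folklore; ✓p819387 `map_withDensity_comp_eq`, inlined to keep the import cone small)
    have hT := measurable_gaugeAct (G := ↥(Matrix.specialUnitaryGroup (Fin 2) ℂ)) u
    have hd : Measurable fun U : GaugeField (F.P K) 0 ↥(Matrix.specialUnitaryGroup (Fin 2) ℂ) =>
        ENNReal.ofReal (boltzmann (F.P K) ((F.scheme ℰp γ).β K) U) := hbm.ennreal_ofReal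
    ext s hs
    rw [Measure.map_apply hT hs, withDensity_apply _ (hT hs), withDensity_apply _ hs, ← (measurePreserving_gaugeAct u).map_eq,
      Measure.restrict_map hT hs, lintegral_map hd hT, (measurePreserving_gaugeAct u).map_eq]
  rw [Measure.map_map (measurable_gaugeAct w) hI, hcomm, ← Measure.map_map hI (measurable_gaugeAct u), hB]

/-- ★★ **THE RUN-`K` LEVEL-`k` DENSITY `resDensity F γ K univ k` IS A.E. GAUGE INVARIANT** (`k ≤ m + K`, `γ ≥ 0`): `ρ_k(W^w) = ρ_k(W)` for `dU_k`-a.e. `W`, every `w`.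
[cite: Balaban1985Averaging, (12)-(13) p.19] -/
theorem resDensity_comp_gaugeAct_ae_eq (hγ : 0 ≤ γ) (K : ℕ) {k : ℕ} (hk : k ≤ F.m + K) (w : GaugeTransf (F.P K) k ↥(Matrix.specialUnitaryGroup (Fin 2) ℂ)) :
    (fun W => resDensity F γ K Set.univ k (GaugeField.gaugeAct w W)) =ᵐ[fieldMeasure (F.P K) k ↥(Matrix.specialUnitaryGroup (Fin 2) ℂ)]
      resDensity F γ K Set.univ k := by
  refine comp_gaugeAct_ae_eq_of_map_withDensity_eq (measurable_resDensity F γ K MeasurableSet.univ k) (resDensity_nonneg F γ K _ k) w ?_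
  rw [← map_iter_withDensity_boltzmann_eq F hγ K hk]
  exact map_gaugeAct_levelLaw F K hk w

/-- ★★★ **THE ONE VERSION AT RUN `K` LEVEL `k`**: `ρ♮ := canonVersion dU_k (orbAvg (resDensity F γ K univ k))` is gauge invariant AT EVERY POINT, measurable, `≥ 0`, `= ρ_k` a.e., a
density of the same level-`k` law, continuous on `regSet dU_k ρ_k`, and every a.e. sandwich `f ≤ ρ_k ≤ g` on an open `U ⊆ regSet` with `f, g` continuous on `U` holds for `ρ♮` at
EVERY point of `U` — the (m2) door's `hρ0`∕`hρm`∕`hρGI` with no residual and its `h47ρ`∕`h41ρ` from `Ineq47AE`∕`Ineq41AE` given window continuity of the bounds and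
`window ⊆ regSet` (UV3-NODE §69.2 δ7∕δ11; px8 g23 ✓`…S1aAlphaMemVersionOfRows`). [cite: Balaban1985UV3, (41) p.266 and (47) p.267] -/
theorem levelVersion_spec (hγ : 0 ≤ γ) (K : ℕ) {k : ℕ} (hk : k ≤ F.m + K) :
    GaugeField.GaugeInvariant (canonVersion (fieldMeasure (F.P K) k ↥(Matrix.specialUnitaryGroup (Fin 2) ℂ)) (orbAvg (resDensity F γ K Set.univ k))) ∧
    Measurable (canonVersion (fieldMeasure (F.P K) k ↥(Matrix.specialUnitaryGroup (Fin 2) ℂ)) (orbAvg (resDensity F γ K Set.univ k))) ∧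
    (∀ W, 0 ≤ canonVersion (fieldMeasure (F.P K) k ↥(Matrix.specialUnitaryGroup (Fin 2) ℂ)) (orbAvg (resDensity F γ K Set.univ k)) W) ∧
    (canonVersion (fieldMeasure (F.P K) k ↥(Matrix.specialUnitaryGroup (Fin 2) ℂ)) (orbAvg (resDensity F γ K Set.univ k))
      =ᵐ[fieldMeasure (F.P K) k ↥(Matrix.specialUnitaryGroup (Fin 2) ℂ)] resDensity F γ K Set.univ k) ∧
    ContinuousOn (canonVersion (fieldMeasure (F.P K) k ↥(Matrix.specialUnitaryGroup (Fin 2) ℂ)) (orbAvg (resDensity F γ K Set.univ k)))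
      (regSet (fieldMeasure (F.P K) k ↥(Matrix.specialUnitaryGroup (Fin 2) ℂ)) (resDensity F γ K Set.univ k)) ∧
    (∀ (U : Set (GaugeField (F.P K) k ↥(Matrix.specialUnitaryGroup (Fin 2) ℂ))), IsOpen U →
      U ⊆ regSet (fieldMeasure (F.P K) k ↥(Matrix.specialUnitaryGroup (Fin 2) ℂ)) (resDensity F γ K Set.univ k) →
      (∀ f : GaugeField (F.P K) k ↥(Matrix.specialUnitaryGroup (Fin 2) ℂ) → ℝ, ContinuousOn f U →
        (∀ᵐ W ∂(fieldMeasure (F.P K) k ↥(Matrix.specialUnitaryGroup (Fin 2) ℂ)).restrict U, f W ≤ resDensity F γ K Set.univ k W) →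
        ∀ W ∈ U, f W ≤ canonVersion (fieldMeasure (F.P K) k ↥(Matrix.specialUnitaryGroup (Fin 2) ℂ)) (orbAvg (resDensity F γ K Set.univ k)) W) ∧
      (∀ g : GaugeField (F.P K) k ↥(Matrix.specialUnitaryGroup (Fin 2) ℂ) → ℝ, ContinuousOn g U →
        (∀ᵐ W ∂(fieldMeasure (F.P K) k ↥(Matrix.specialUnitaryGroup (Fin 2) ℂ)).restrict U, resDensity F γ K Set.univ k W ≤ g W) →
        ∀ W ∈ U, canonVersion (fieldMeasure (F.P K) k ↥(Matrix.specialUnitaryGroup (Fin 2) ℂ)) (orbAvg (resDensity F γ K Set.univ k)) W ≤ g W)) := by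
  have hsm : AEStronglyMeasurable (resDensity F γ K Set.univ k) (fieldMeasure (F.P K) k ↥(Matrix.specialUnitaryGroup (Fin 2) ℂ)) :=
    (measurable_resDensity F γ K MeasurableSet.univ k).aestronglyMeasurable
  have hinv := resDensity_comp_gaugeAct_ae_eq F hγ K hk
  exact ⟨gaugeInvariant_canonVersion_orbAvg _, measurable_canonVersion_orbAvg (measurable_resDensity F γ K MeasurableSet.univ k),
    canonVersion_orbAvg_nonneg (resDensity_nonneg F γ K _ k), canonVersion_orbAvg_ae_eq hsm hinv, continuousOn_canonVersion_orbAvg hsm hinv,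
    fun U hU hUreg => ⟨fun f hf hle => le_canonVersion_orbAvg_on hsm hinv hU hUreg hf hle,
      fun g hg hle => canonVersion_orbAvg_le_on hsm hinv hU hUreg hg hle⟩⟩

end Summit.QuantumFields.YangMills.Theorems.FluctuationComparisonRegPrIntLS1aLevelLawInvariance

end
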